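import Literature.MathematicalPhysics.QuantumLattice.HubbardShiftedSliceCovariance
import Literature.MathematicalPhysics.QuantumLattice.HubbardSectorPhaseSpaceCount
import Literature.MathematicalPhysics.QuantumLattice.TorusShellCounting
import HarnessLib

/-!
# The Gram constant of a (shifted) Salmhofer slice of the Hubbard torus, WITHOUT sectors: `κ² ≲ Λ′²/Λ`

Topic `MathematicalPhysics/QuantumLattice`; the sector-free instance of `HubbardSectorPhaseSpaceCount.norm_sq_sectorGramF_le`
(Benfatto–Giuliani–Mastropietro 2006, (2.80): the Gram constant of a single-scale propagator is the sup of the symbol times the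
phase-space count of its support) for the shifted slice covariance `hubbardCovSliceShifted β μ θ Λ Λ′` of
`HubbardShiftedSliceCovariance.lean` (symbol `(w_Λ - w_{Λ′})·βL²/(-i(ω+θ)+ξ)`, `Λ < Λ′`).  The slice weight lives on the shell
`Λ²/4 < ω² + ξ² < Λ′²` (Salmhofer's cutoff `χ₂` is `0` below `¼` and `1` above `1`), where `√(ω²+ξ²) > Λ/2`, so the symbol is
`≤ (8/3)βL²/Λ` there (`norm_shiftedFreeSymbol_le`), and the shell is contained in `{|ω| ≤ Λ′} × {|ε(k⃗) - μ| < Λ′}`, counted by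
`card_filter_matsubaraFreq_le` and the SHARP shell count `card_torusShell_le` (`≲ Λ′L² + L` away from the van Hove level and the
band edges — the crude `√Λ′` count of `TorusShellCountUniform` would spoil the power counting of the `βU ≤ κ` corner):

* `hubbardCutoffWeight_sub_eq_zero_of_le`, `…_of_ge` — the slice weight vanishes off the shell;
* `support_sliceWeight` — on its support `Λ²/4 < ω² + ξ² < Λ′²`;
* **`norm_sq_sectorGramF_shiftedSlice_le`** — for multipliers `‖F_ω(k)‖ ≤ 1`, `0 < β`, `0 < Λ ≤ Λ′ ≤ d₀/2` (`d₀` the distance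
  of `μ` to `{-4, 0}`), `|θ| ≤ π/(4β)`:
  `‖F_Y‖² ≤ (βL²)^{-2} · (Λ′β/π + 3) · 4L(Λ′L/(2π√(d₀/8)) + 1) · (8/3)βL²/Λ  ≍  Λ′²/Λ` — the Gram constant `κ_j²` of engine E1
  of the `βU ≤ κ` corner (cell gate-hubbard-kl, R0-SCOPE-2 §5); the same bound holds for the right Gram vector.

Everything is proved; no definitions, no named facts.

## Sources

G. Benfatto, A. Giuliani, V. Mastropietro, Ann. Henri Poincaré 7 (2006) 809–898, §2.5 (2.50), §2.8 (2.80) and footnote ¹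
(`BenfattoGiulianiMastropietro2006`); M. Salmhofer, *Renormalization* (1999), §4.2.5 (4.70)–(4.71) (`Salmhofer1999`).
-/

noncomputable section

namespace Literature.MathematicalPhysics.QuantumLattice

open Literature.Probability.LatticeModels GrassmannAlgebra Finset

variable {L M : ℕ}

/-! ### The support of the slice weight -/

/-- Below both scales the slice weight vanishes: `ω² + ξ² ≤ Λ²/4`, `Λ ≤ Λ′` ⇒ `w_Λ(k) - w_{Λ′}(k) = 0`. [cite: Salmhofer1999, §4.2.5 (4.71)] -/
theorem hubbardCutoffWeight_sub_eq_zero_of_le {β μ Λ Λ' : ℝ} (hΛ : 0 < Λ) (hΛΛ' : Λ ≤ Λ') (k : FreqMomentum L M)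
    (hk : matsubaraFreq β M k.1 ^ 2 + nambuXi L μ k.2 ^ 2 ≤ Λ ^ 2 / 4) :
    hubbardCutoffWeight L M β μ Λ k - hubbardCutoffWeight L M β μ Λ' k = 0 := by
  have hΛ' : 0 < Λ' := hΛ.trans_le hΛΛ'
  have h1 : hubbardCutoffWeight L M β μ Λ k = 0 := by
    rw [hubbardCutoffWeight]
    refine salmhoferCutoff_of_le ?_
    rw [div_le_iff₀ (by positivity)]
    linarith
  have h2 : hubbardCutoffWeight L M β μ Λ' k = 0 := by
    rw [hubbardCutoffWeight]
    refine salmhoferCutoff_of_le ?_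
    rw [div_le_iff₀ (by positivity)]
    have : Λ ^ 2 ≤ Λ' ^ 2 := pow_le_pow_left₀ hΛ.le hΛΛ' 2
    linarith
  rw [h1, h2, sub_zero]

/-- Above both scales the slice weight vanishes: `Λ′² ≤ ω² + ξ²`, `Λ ≤ Λ′` ⇒ `w_Λ(k) - w_{Λ′}(k) = 0`. [cite: Salmhofer1999, §4.2.5 (4.71)] -/
theorem hubbardCutoffWeight_sub_eq_zero_of_ge {β μ Λ Λ' : ℝ} (hΛ : 0 < Λ) (hΛΛ' : Λ ≤ Λ') (k : FreqMomentum L M)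
    (hk : Λ' ^ 2 ≤ matsubaraFreq β M k.1 ^ 2 + nambuXi L μ k.2 ^ 2) :
    hubbardCutoffWeight L M β μ Λ k - hubbardCutoffWeight L M β μ Λ' k = 0 := by
  have hΛ' : 0 < Λ' := hΛ.trans_le hΛΛ'
  have h1 : hubbardCutoffWeight L M β μ Λ k = 1 := by
    rw [hubbardCutoffWeight]
    refine salmhoferCutoff_of_ge ?_
    rw [le_div_iff₀ (by positivity)]
    have : Λ ^ 2 ≤ Λ' ^ 2 := pow_le_pow_left₀ hΛ.le hΛΛ' 2
    linarith
  have h2 : hubbardCutoffWeight L M β μ Λ' k = 1 := by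
    rw [hubbardCutoffWeight]
    refine salmhoferCutoff_of_ge ?_
    rw [le_div_iff₀ (by positivity)]
    linarith
  rw [h1, h2, sub_self]

/-- **The slice weight lives on the shell** `Λ²/4 < ω² + ξ² < Λ′²`. [cite: Salmhofer1999, §4.2.5 (4.70)] -/
theorem support_sliceWeight {β μ Λ Λ' : ℝ} (hΛ : 0 < Λ) (hΛΛ' : Λ ≤ Λ') (k : FreqMomentum L M)
    (hk : hubbardCutoffWeight L M β μ Λ k - hubbardCutoffWeight L M β μ Λ' k ≠ 0) :
    Λ ^ 2 / 4 < matsubaraFreq β M k.1 ^ 2 + nambuXi L μ k.2 ^ 2 ∧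
      matsubaraFreq β M k.1 ^ 2 + nambuXi L μ k.2 ^ 2 < Λ' ^ 2 := by
  constructor
  · by_contra h
    exact hk (hubbardCutoffWeight_sub_eq_zero_of_le hΛ hΛΛ' k (not_lt.1 h))
  · by_contra h
    exact hk (hubbardCutoffWeight_sub_eq_zero_of_ge hΛ hΛΛ' k (not_lt.1 h))

/-- The slice weight is bounded by `1` in absolute value (both cutoffs lie in `[0,1]`). [cite: Salmhofer1999, §4.2.5 (4.71)] -/
theorem abs_sliceWeight_le_one (β μ Λ Λ' : ℝ) (k : FreqMomentum L M) :
    |hubbardCutoffWeight L M β μ Λ k - hubbardCutoffWeight L M β μ Λ' k| ≤ 1 := by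
  have h1 := salmhoferCutoff_mem_Icc ((matsubaraFreq β M k.1 ^ 2 + nambuXi L μ k.2 ^ 2) / Λ ^ 2)
  have h2 := salmhoferCutoff_mem_Icc ((matsubaraFreq β M k.1 ^ 2 + nambuXi L μ k.2 ^ 2) / Λ' ^ 2)
  rw [hubbardCutoffWeight, hubbardCutoffWeight, abs_le]
  constructor <;> linarith [h1.1, h1.2, h2.1, h2.2]

/-! ### The sup of the slice symbol and the phase-space count -/

/-- **On the shell the slice symbol is at most `(8/3)βL²/Λ`** (`0 < β`, `|θ| ≤ π/(4β)`, `0 < Λ ≤ Λ′`).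
[cite: BenfattoGiulianiMastropietro2006, §2.5 (2.50)] -/
theorem norm_sliceSymbol_le [NeZero L] {β : ℝ} (hβ : 0 < β) (μ : ℝ) {θ : ℝ} (hθ : |θ| ≤ Real.pi / (4 * β))
    {Λ Λ' : ℝ} (hΛ : 0 < Λ) (hΛΛ' : Λ ≤ Λ') (ks : FreqMomentum L M × Fin 2) :
    ‖((hubbardCutoffWeight L M β μ Λ ks.1 : ℂ) - (hubbardCutoffWeight L M β μ Λ' ks.1 : ℂ)) * shiftedFreeSymbol L M β μ θ ks‖ ≤
      8 / 3 * (β * (L : ℝ) ^ 2) / Λ := by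
  by_cases hk : hubbardCutoffWeight L M β μ Λ ks.1 - hubbardCutoffWeight L M β μ Λ' ks.1 = 0
  · have : ((hubbardCutoffWeight L M β μ Λ ks.1 : ℂ) - (hubbardCutoffWeight L M β μ Λ' ks.1 : ℂ)) = 0 := by
      exact_mod_cast hk
    rw [this, zero_mul, norm_zero]
    positivity
  · obtain ⟨hlow, -⟩ := support_sliceWeight hΛ hΛΛ' ks.1 hk
    have hw : ‖((hubbardCutoffWeight L M β μ Λ ks.1 : ℂ) - (hubbardCutoffWeight L M β μ Λ' ks.1 : ℂ))‖ ≤ 1 := by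
      rw [← Complex.ofReal_sub, Complex.norm_real, Real.norm_eq_abs]
      exact abs_sliceWeight_le_one β μ Λ Λ' ks.1
    have hsym := norm_shiftedFreeSymbol_le (L := L) (M := M) hβ μ hθ ks
    have hsqrt : Λ / 2 ≤ Real.sqrt (matsubaraFreq β M ks.1.1 ^ 2 + nambuXi L μ ks.1.2 ^ 2) := by
      rw [show Λ / 2 = Real.sqrt ((Λ / 2) ^ 2) by rw [Real.sqrt_sq (by positivity)]]
      exact Real.sqrt_le_sqrt (by linarith)
    have hs0 : 0 < Real.sqrt (matsubaraFreq β M ks.1.1 ^ 2 + nambuXi L μ ks.1.2 ^ 2) := lt_of_lt_of_le (by positivity) hsqrt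
    have hsym' : ‖shiftedFreeSymbol L M β μ θ ks‖ ≤ 8 / 3 * (β * (L : ℝ) ^ 2) / Λ := by
      refine hsym.trans ?_
      rw [div_le_div_iff₀ hs0 hΛ]
      have hβL : 0 ≤ 4 / 3 * (β * (L : ℝ) ^ 2) := by positivity
      nlinarith [mul_le_mul_of_nonneg_left hsqrt hβL]
    calc ‖((hubbardCutoffWeight L M β μ Λ ks.1 : ℂ) - (hubbardCutoffWeight L M β μ Λ' ks.1 : ℂ)) * shiftedFreeSymbol L M β μ θ ks‖
        = ‖((hubbardCutoffWeight L M β μ Λ ks.1 : ℂ) - (hubbardCutoffWeight L M β μ Λ' ks.1 : ℂ))‖ *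
            ‖shiftedFreeSymbol L M β μ θ ks‖ := norm_mul _ _
      _ ≤ 1 * (8 / 3 * (β * (L : ℝ) ^ 2) / Λ) := mul_le_mul hw hsym' (norm_nonneg _) zero_le_one
      _ = 8 / 3 * (β * (L : ℝ) ^ 2) / Λ := one_mul _

/-- **The phase-space count of the shell** `{|ω| ≤ Λ′} × {|ε(k⃗) - μ| < Λ′}`:
`≤ (Λ′β/π + 3) · 4L(Λ′L/(2π√(d₀/8)) + 1)` for `μ` at distance `≥ d₀` from `{-4, 0}` and `0 < Λ′ ≤ d₀/2` (the Matsubara count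
times the sharp shell count). [cite: BenfattoGiulianiMastropietro2006, §2.8 (2.80)] -/
theorem card_shellSupport_le [NeZero L] {β : ℝ} (hβ : 0 < β) {μ d₀ Λ' : ℝ} (hμ4 : d₀ ≤ μ + 4) (hμ0 : d₀ ≤ -μ)
    (hΛ' : 0 < Λ') (hΛ'd : Λ' ≤ d₀ / 2) :
    ((((univ : Finset (FreqMomentum L M)).filter fun k =>
        |matsubaraFreq β M k.1| ≤ Λ' ∧ |torusBand L k.2 - μ| < Λ').card : ℕ) : ℝ) ≤
      (Λ' * β / Real.pi + 3) * (4 * (L * (Λ' * L / (2 * Real.pi * Real.sqrt (d₀ / 8)) + 1))) := by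
  classical
  rw [card_filter_freqMomentum_eq (fun i : MatsubaraIdx M => |matsubaraFreq β M i| ≤ Λ')
    (fun k : TorusSite 2 L => |torusBand L k - μ| < Λ'), Nat.cast_mul]
  refine mul_le_mul (card_filter_matsubaraFreq_le hβ hΛ'.le _ fun i hi => (mem_filter.1 hi).2)
    (card_torusShell_le hμ4 hμ0 hΛ' hΛ'd) (Nat.cast_nonneg _) (by positivity)

/-- **The Gram constant of the sector-free shifted slice** (Benfatto–Giuliani–Mastropietro 2006, (2.80), read without
sectors): for multipliers `‖F_ω(k)‖ ≤ 1`, `0 < β`, `0 < Λ ≤ Λ′ ≤ d₀/2` with `μ` at distance `≥ d₀` from `{-4, 0}`, and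
`|θ| ≤ π/(4β)`, the left Gram vector of the pulled-back slice covariance `Sᵀ C^{θ}_{(Λ,Λ′]} S` satisfies
`‖F_Y‖² ≤ (βL²)^{-2} · [(Λ′β/π + 3) · 4L(Λ′L/(2π√(d₀/8)) + 1)] · (8/3)βL²/Λ ≍ Λ′²/Λ`.
[cite: BenfattoGiulianiMastropietro2006, §2.8 (2.80)] -/
theorem norm_sq_sectorGramF_shiftedSlice_le [NeZero L] {N : ℕ} {β : ℝ} (hβ : 0 < β) {μ d₀ : ℝ} (hμ4 : d₀ ≤ μ + 4)
    (hμ0 : d₀ ≤ -μ) {θ : ℝ} (hθ : |θ| ≤ Real.pi / (4 * β)) {Λ Λ' : ℝ} (hΛ : 0 < Λ) (hΛΛ' : Λ ≤ Λ') (hΛ'd : Λ' ≤ d₀ / 2)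
    (F : Fin N → FreqMomentum L M → ℂ) (hF : ∀ ω k, ‖F ω k‖ ≤ 1) (Y : SpaceTimeIdx L M × SectorLeg N) :
    ‖sectorGramF L M β F (fun ks => ((hubbardCutoffWeight L M β μ Λ ks.1 : ℂ) - (hubbardCutoffWeight L M β μ Λ' ks.1 : ℂ)) *
        shiftedFreeSymbol L M β μ θ ks) Y‖ ^ 2 ≤
      ‖((1 / (β * (L : ℝ) ^ 2) : ℝ) : ℂ)‖ ^ 2 *
        (((Λ' * β / Real.pi + 3) * (4 * (L * (Λ' * L / (2 * Real.pi * Real.sqrt (d₀ / 8)) + 1)))) *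
          (8 / 3 * (β * (L : ℝ) ^ 2) / Λ)) := by
  classical
  have hΛ' : 0 < Λ' := hΛ.trans_le hΛΛ'
  set T : Finset (FreqMomentum L M) := (univ : Finset (FreqMomentum L M)).filter fun k =>
    |matsubaraFreq β M k.1| ≤ Λ' ∧ |torusBand L k.2 - μ| < Λ' with hT
  have h := norm_sq_sectorGramF_le (L := L) (M := M) β F
    (fun ks => ((hubbardCutoffWeight L M β μ Λ ks.1 : ℂ) - (hubbardCutoffWeight L M β μ Λ' ks.1 : ℂ)) *
      shiftedFreeSymbol L M β μ θ ks) Y (S := 8 / 3 * (β * (L : ℝ) ^ 2) / Λ) (fun k => ?_) T (fun k _ hp => ?_)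
  · refine h.trans (mul_le_mul_of_nonneg_left ?_ (by positivity))
    exact mul_le_mul_of_nonneg_right (card_shellSupport_le hβ hμ4 hμ0 hΛ' hΛ'd) (by positivity)
  · -- the sup: `‖F‖² ‖p‖ ≤ 1 · (8/3)βL²/Λ`
    have h1 : ‖F Y.2.1.1 k‖ ^ 2 ≤ 1 := by
      have := hF Y.2.1.1 k
      nlinarith [norm_nonneg (F Y.2.1.1 k)]
    calc ‖F Y.2.1.1 k‖ ^ 2 * ‖((hubbardCutoffWeight L M β μ Λ (k, Y.2.1.2).1 : ℂ) -
            (hubbardCutoffWeight L M β μ Λ' (k, Y.2.1.2).1 : ℂ)) * shiftedFreeSymbol L M β μ θ (k, Y.2.1.2)‖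
        ≤ 1 * (8 / 3 * (β * (L : ℝ) ^ 2) / Λ) :=
          mul_le_mul h1 (norm_sliceSymbol_le hβ μ hθ hΛ hΛΛ' (k, Y.2.1.2)) (norm_nonneg _) zero_le_one
      _ = 8 / 3 * (β * (L : ℝ) ^ 2) / Λ := one_mul _
  · -- the support: a nonzero symbol forces `k` into the shell
    have hw : hubbardCutoffWeight L M β μ Λ k - hubbardCutoffWeight L M β μ Λ' k ≠ 0 := by
      intro h0
      apply hp
      have : ((hubbardCutoffWeight L M β μ Λ k : ℂ) - (hubbardCutoffWeight L M β μ Λ' k : ℂ)) = 0 := by exact_mod_cast h0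
      simp only [this, zero_mul]
    obtain ⟨-, hhi⟩ := support_sliceWeight hΛ hΛΛ' k hw
    rw [hT, mem_filter]
    refine ⟨mem_univ _, ?_, ?_⟩
    · have : matsubaraFreq β M k.1 ^ 2 ≤ Λ' ^ 2 := by nlinarith [sq_nonneg (nambuXi L μ k.2)]
      exact abs_le_of_sq_le_sq' this hΛ'.le |>.elim (fun h1 h2 => abs_le.2 ⟨h1, h2⟩)
    · have hξ : nambuXi L μ k.2 ^ 2 < Λ' ^ 2 := by nlinarith [sq_nonneg (matsubaraFreq β M k.1)]
      have := abs_lt_of_sq_lt_sq' hξ hΛ'.le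
      rw [nambuXi] at this
      exact abs_lt.2 this

end Literature.MathematicalPhysics.QuantumLattice

end
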